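import Mathlib
import HarnessLib
import Summits.NavierStokesRegularity.NavierStokesRegularity.Theorems.UnthreadedDoorNetFluxNullTimeDefs
import Summits.NavierStokesRegularity.NavierStokesRegularity.Theorems.UnthreadedDoorNetFluxTypeIDichotomy

/-!
# Route `UnthreadedDoor`, crux `PoloidalLiouville` (stmt-NavierStokesRegularity-1222), WALL W1 — C⁻'s residual ⇐ the persistent-sheet
# residual, BY NAME

`multiHillScalarLiouvilleTypeI_of_persistentSheetResidual : PersistentSheetResidualTypeI → MultiHillScalarLiouvilleTypeI` over the two
Theorems-side NAMED residuals (`NetFlux.PersistentSheetResidualTypeI`, p689447; `NetFlux.MultiHillScalarLiouvilleTypeI`, NetFluxDefs) —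
the named form of `multiHillScalarLiouvilleTypeI_of_persistentSheet` (p689590, Type-I dichotomy after the K3ᵃᵉ rung p688761).  With
`poloidalLiouvilleTypeI_of_multiHill` (p677092) this reads: C⁻ `PoloidalLiouvilleTypeI` ⇐ `PersistentSheetResidualTypeI`.  HONEST: a
reduction between OPEN statements; `PoloidalLiouville` (1222), `stub_scalarLiouville`, W1 and NS regularity are OPEN and not addressed.
`--supports stmt-NavierStokesRegularity-1222 --as helper`.
-/

noncomputable section

-- the summit and its single sub-problem share the name (CONVENTIONS §1)
set_option linter.dupNamespace false

namespace Summit.NavierStokesRegularity.NavierStokesRegularity.Theorems.PoloidalLiouville.NetFlux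

/-- **C⁻'s named residual `MultiHillScalarLiouvilleTypeI` follows from the named persistent-sheet residual `PersistentSheetResidualTypeI`**
(Type-I dichotomy `typeI_unthreaded_dichotomy`, i.e. the rung K3ᵃᵉ p688761 read contrapositively). [folklore] -/
theorem multiHillScalarLiouvilleTypeI_of_persistentSheetResidual (h : PersistentSheetResidualTypeI) :
    MultiHillScalarLiouvilleTypeI :=
  multiHillScalarLiouvilleTypeI_of_persistentSheet h

end Summit.NavierStokesRegularity.NavierStokesRegularity.Theorems.PoloidalLiouville.NetFlux
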